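import Summits.CriticalPhenomena.Ising3DConformalLimit.Theorems.IsingEuclidUpgradeIsingEuclidUpgradeR2RotInvPowerLawRayRigidity
import Summits.CriticalPhenomena.Ising3DConformalLimit.Theorems.IsingEuclidUpgradeIsingEuclidUpgradeR2RotInvPowerLawUniformDilation
import Summits.CriticalPhenomena.Ising3DConformalLimit.Theorems.IsingEuclidUpgradeIsingEuclidUpgradeR2RotInvPowerLawSplit
import Summits.CriticalPhenomena.Ising3DConformalLimit.Theses.PrecisionLaplacian
import HarnessLib

/-!
# Crux `IsingEuclidUpgradeR2RotInvPowerLaw` (stmt-CriticalPhenomena-0634), line `tower_profile_rigidity`: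
# the LOSSLESS radial glue TOWER × RAYS — `r2 ⟺ T1 ∧ Sray`

Write `G := criticalTwoPoint 3` for the critical two-point function `⟨σ₀σ_x⟩_{β_c}` of the
nearest-neighbour Ising model on `ℤ³`, `g(n) := G(n e₀)`, `|x|₂ := √(∑ xᵢ²)`. The crux r2 is the isotropic
pure power law `∃ Δ c > 0, G(x)|x|₂^{2Δ} → c` cofinitely. This file proves, sorry-free and from LANDED
inputs only, that r2 is EQUIVALENT to the conjunction of two purely RADIAL existence-of-limit statements:

* T1 (dyadic tower law) `∃ Δ c > 0, g(2^j)·(2^j)^{2Δ} → c` — the normalised axis two-point function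
  converges along the single geometric sequence `n = 2^j` (the PURITY content: no drifting slowly varying
  factor);
* Sray (ray dilation law) `∃ Δ ∀ v ≠ 0 ∀ k ≥ 1, G(knv)·k^{2Δ}/G(nv) → 1` — integer dilation ratios converge
  along every lattice ray, with a common exponent (ray-wise regular variation; NO comparison between rays).

`IsingEuclidUpgradeR2RotInvPowerLaw_of_towerLaw_of_rayLaw : T1 → Sray → r2` (the registered glue name) is
assembled from the landed stub files of the line: Sray at `Δ` restricted to the axis is the integer
dilation law S2 at `Δ`; the landed transfer U (`stub_uniformDilationTransfer`, classical regular variation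
from axis log-convexity and Messager–Miracle-Solé monotonicity) makes it uniform on windows `[b, 2b]`;
T1 ∧ S2 ∧ U give the axial pure power law D1 (`axisPowerLaw_of_towerLaw_of_dilationLawAt`: the two
exponents coincide, then `g(n)n^{2Δ} = [g(n)(n/bₙ)^{2Δ}/g(bₙ)]·[g(bₙ)bₙ^{2Δ}]`, `bₙ = 2^{⌊log₂ n⌋}`);
the landed rigidity transfer Rray (`stub_rayRigidityTransfer`: ray regular variation ⇒ pinned pair zoom
converges to `‖·‖^{-2Δ}` by nine-mirror reflection-positivity rigidity `HRP2Rigidity_of` ⇒ ratio isotropy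
`G(x)/g(⌊|x|₂⌋) → 1`) supplies the angular factor; and the landed AXIS × ANGLE glue
(`IsingEuclidUpgradeR2Split.IsingEuclidUpgradeR2RotInvPowerLaw_of_subs`) concludes. Conversely r2 ⇒ T1
(restrict to the tower) and r2 ⇒ Sray (`RayRV.rayRV_of_rotInvPowerLaw`), whence
`rotInvPowerLaw_iff_towerLaw_and_rayLaw : r2 ↔ T1 ∧ Sray`.

Reading: ROTATION INVARIANCE AND UNIFORMITY ARE THEOREMS; the open content of the crux is exactly "one
tower converges" ∧ "dilation ratios converge along every ray" (Duminil-Copin, ICM 2022, §8.1/§8.4: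
neither the existence of `η` nor rotation invariance of `⟨σ₀σ_x⟩_{β_c}` is known on `ℤ³`). A planner can
file the route-level split TOWER × RAYS with this glue. No definitions are introduced.
-/

noncomputable section

namespace Summit.CriticalPhenomena.Ising3DConformalLimit.Cruxes.IsingEuclidUpgradeR2RotInvPowerLaw.TowerProfileRigidity

open Filter Topology Literature.Probability.LatticeModels
open Summit.CriticalPhenomena.Ising3DConformalLimit.Theorems.IsingEuclidUpgradeR2Split
  (IsingEuclidUpgradeR2RotInvPowerLaw_of_subs axisPowerLaw_of_rotInvPowerLaw)
open Summit.CriticalPhenomena.Ising3DConformalLimit.HarmonicMomentsIsotropyTwoPoint.RayRV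
  (rayRV_of_rotInvPowerLaw)

/-! ### Sray ⇒ S2: the ray law restricted to the axis -/

/-- The ray dilation law at exponent `Δ`, restricted to the axis ray `ℤe₀`, is the integer dilation law S2
at the same exponent. [folklore] -/
theorem dilationLawAt_of_rayLawAt {Δ : ℝ}
    (h : ∀ v : Site 3, v ≠ 0 → ∀ k : ℕ, 1 ≤ k → Tendsto (fun n : ℕ =>
      criticalTwoPoint 3 (((k * n : ℕ) : ℤ) • v) * (k : ℝ) ^ (2 * Δ) /
        criticalTwoPoint 3 (((n : ℕ) : ℤ) • v)) atTop (𝓝 1)) :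
    ∀ k : ℕ, 1 ≤ k → Tendsto (fun n : ℕ =>
      criticalTwoPoint 3 (Pi.single 0 ((k * n : ℕ) : ℤ)) * (k : ℝ) ^ (2 * Δ) /
        criticalTwoPoint 3 (Pi.single 0 ((n : ℕ) : ℤ))) atTop (𝓝 1) := by
  intro k hk
  have hv : (Pi.single 0 (1 : ℤ) : Site 3) ≠ 0 := by
    intro h0
    have := congrFun h0 0
    simp at this
  have hsm : ∀ m : ℤ, (m • (Pi.single 0 (1 : ℤ) : Site 3)) = Pi.single 0 m := by
    intro m
    ext j
    by_cases hj : j = 0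
    · subst hj; simp
    · simp [hj]
  have h' := h (Pi.single 0 (1 : ℤ)) hv k hk
  refine h'.congr fun n => ?_
  simp only [hsm]

/-! ### T1 ∧ S2 ⇒ D1 (with the landed transfer U) -/

/-- **T1 ∧ S2-at-`Δ` ⇒ D1 (axial pure power law).** The tower exponent equals `Δ` (both give the limit of
`g(2^{j+1})/g(2^j)`); then `g(n)n^{2Δ} = [g(n)(n/bₙ)^{2Δ}/g(bₙ)]·[g(bₙ)bₙ^{2Δ}]` with
`bₙ := 2^{⌊log₂ n⌋}`: the first factor `→ 1` by the landed uniform law U (`stub_uniformDilationTransfer`,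
window `bₙ ≤ n < 2bₙ`), the second `→ c` by T1. [folklore] -/
theorem axisPowerLaw_of_towerLaw_of_dilationLawAt
    (hT : ∃ Δ c : ℝ, 0 < c ∧ Tendsto (fun j : ℕ =>
      criticalTwoPoint 3 (Pi.single 0 ((2 ^ j : ℕ) : ℤ)) * ((2 ^ j : ℕ) : ℝ) ^ (2 * Δ)) atTop (𝓝 c))
    {Δ : ℝ} (hdil : ∀ k : ℕ, 1 ≤ k → Tendsto (fun n : ℕ =>
      criticalTwoPoint 3 (Pi.single 0 ((k * n : ℕ) : ℤ)) * (k : ℝ) ^ (2 * Δ) /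
        criticalTwoPoint 3 (Pi.single 0 ((n : ℕ) : ℤ))) atTop (𝓝 1)) :
    ∃ Δ c : ℝ, 0 < c ∧ Tendsto (fun n : ℕ =>
      criticalTwoPoint 3 (Pi.single 0 ((n : ℕ) : ℤ)) * (n : ℝ) ^ (2 * Δ)) atTop (𝓝 c) := by
  obtain ⟨Δ₁, c, hc, htower⟩ := hT
  set g : ℕ → ℝ := fun n => criticalTwoPoint 3 (Pi.single 0 ((n : ℕ) : ℤ)) with hg
  have gpos : ∀ n, 0 < g n := fun n => criticalTwoPoint_axis_pos n
  -- Step 1: `Δ₁ = Δ`.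
  have hA0 : Tendsto (fun j : ℕ => (g (2 ^ (j + 1)) * ((2 ^ (j + 1) : ℕ) : ℝ) ^ (2 * Δ₁)) /
      (g (2 ^ j) * ((2 ^ j : ℕ) : ℝ) ^ (2 * Δ₁))) atTop (𝓝 (c / c)) :=
    (htower.comp (tendsto_add_atTop_nat 1)).div htower hc.ne'
  have hA : Tendsto (fun j : ℕ => g (2 ^ (j + 1)) * (2 : ℝ) ^ (2 * Δ₁) / g (2 ^ j)) atTop (𝓝 1) := by
    rw [div_self hc.ne'] at hA0
    refine hA0.congr fun j => ?_
    have h2j : (0 : ℝ) < ((2 ^ j : ℕ) : ℝ) := by positivity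
    have hgj : g (2 ^ j) ≠ 0 := (gpos _).ne'
    have hrj : ((2 ^ j : ℕ) : ℝ) ^ (2 * Δ₁) ≠ 0 := (Real.rpow_pos_of_pos h2j _).ne'
    have hsplit : ((2 ^ (j + 1) : ℕ) : ℝ) ^ (2 * Δ₁) = ((2 ^ j : ℕ) : ℝ) ^ (2 * Δ₁) * (2 : ℝ) ^ (2 * Δ₁) := by
      rw [pow_succ, Nat.cast_mul, Nat.cast_ofNat, Real.mul_rpow h2j.le (by norm_num : (0 : ℝ) ≤ 2)]
    rw [hsplit]
    field_simp
  have hB : Tendsto (fun j : ℕ => g (2 ^ (j + 1)) * (2 : ℝ) ^ (2 * Δ) / g (2 ^ j)) atTop (𝓝 1) := by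
    have h := (hdil 2 (by norm_num)).comp (tendsto_pow_atTop_atTop_of_one_lt one_lt_two)
    refine h.congr fun j => ?_
    simp only [Function.comp_apply, hg, Nat.cast_ofNat, pow_succ']
  have hΔ : Δ₁ = Δ := by
    have hq : Tendsto (fun j : ℕ => (g (2 ^ (j + 1)) * (2 : ℝ) ^ (2 * Δ₁) / g (2 ^ j)) /
        (g (2 ^ (j + 1)) * (2 : ℝ) ^ (2 * Δ) / g (2 ^ j))) atTop (𝓝 (1 / 1)) := hA.div hB one_ne_zero
    have hconst : Tendsto (fun _ : ℕ => (2 : ℝ) ^ (2 * Δ₁) / (2 : ℝ) ^ (2 * Δ)) atTop (𝓝 (1 / 1)) := by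
      refine hq.congr fun j => ?_
      have h1 : g (2 ^ (j + 1)) ≠ 0 := (gpos _).ne'
      have h2 : g (2 ^ j) ≠ 0 := (gpos _).ne'
      have h3 : (2 : ℝ) ^ (2 * Δ₁) ≠ 0 := (Real.rpow_pos_of_pos (by norm_num) _).ne'
      have h4 : (2 : ℝ) ^ (2 * Δ) ≠ 0 := (Real.rpow_pos_of_pos (by norm_num) _).ne'
      field_simp
    rw [div_one] at hconst
    have heq : (2 : ℝ) ^ (2 * Δ₁) / (2 : ℝ) ^ (2 * Δ) = 1 := tendsto_nhds_unique tendsto_const_nhds hconst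
    rw [div_eq_one_iff_eq (Real.rpow_pos_of_pos (by norm_num) _).ne'] at heq
    have hlog := congrArg Real.log heq
    rw [Real.log_rpow (by norm_num : (0 : ℝ) < 2), Real.log_rpow (by norm_num : (0 : ℝ) < 2)] at hlog
    have hl2 : Real.log 2 ≠ 0 := (Real.log_pos (by norm_num : (1 : ℝ) < 2)).ne'
    have h2 : 2 * Δ₁ = 2 * Δ := mul_right_cancel₀ hl2 hlog
    linarith
  subst hΔ
  -- Step 2: the dyadic base point `b n := 2^{⌊log₂ n⌋}`
  have hlog_top : Tendsto (fun n : ℕ => Nat.log 2 n) atTop atTop := by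
    refine tendsto_atTop_atTop.2 fun M => ⟨2 ^ M, fun n hn => ?_⟩
    exact Nat.le_log_of_pow_le one_lt_two hn
  set b : ℕ → ℕ := fun n => 2 ^ Nat.log 2 n with hb
  have hb_top : Tendsto b atTop atTop :=
    (tendsto_pow_atTop_atTop_of_one_lt one_lt_two).comp hlog_top
  have hwin : ∀ᶠ n : ℕ in atTop, b n ≤ (fun i : ℕ => i) n ∧ (fun i : ℕ => i) n ≤ 2 * b n := by
    filter_upwards [eventually_ge_atTop 1] with n hn
    refine ⟨Nat.pow_log_le_self 2 (by omega), ?_⟩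
    have h := Nat.lt_pow_succ_log_self one_lt_two n
    have h' : 2 ^ (Nat.log 2 n).succ = 2 * b n := by rw [hb, pow_succ, mul_comm]
    omega
  -- U (landed): `g(n)(n/bₙ)^{2Δ}/g(bₙ) → 1`
  have h1 : Tendsto (fun n : ℕ => g n * ((n : ℝ) / (b n : ℝ)) ^ (2 * Δ₁) / g (b n)) atTop (𝓝 1) :=
    stub_uniformDilationTransfer Δ₁ hdil b (fun i : ℕ => i) hb_top hwin
  -- T1 along `⌊log₂ n⌋`: `g(bₙ) bₙ^{2Δ} → c`
  have h2 : Tendsto (fun n : ℕ => g (b n) * ((b n : ℕ) : ℝ) ^ (2 * Δ₁)) atTop (𝓝 c) :=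
    htower.comp hlog_top
  have hprod : Tendsto (fun n : ℕ => (g n * ((n : ℝ) / (b n : ℝ)) ^ (2 * Δ₁) / g (b n)) *
      (g (b n) * ((b n : ℕ) : ℝ) ^ (2 * Δ₁))) atTop (𝓝 c) := by
    have h := h1.mul h2
    rwa [one_mul] at h
  refine ⟨Δ₁, c, hc, hprod.congr' ?_⟩
  filter_upwards [eventually_ge_atTop 1] with n hn
  show _ = g n * (n : ℝ) ^ (2 * Δ₁)
  have hbpos : (0 : ℝ) < (b n : ℝ) := by positivity
  have hnn : (0 : ℝ) ≤ (n : ℝ) := by positivity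
  have hgb : g (b n) ≠ 0 := (gpos _).ne'
  have hbr : ((b n : ℕ) : ℝ) ^ (2 * Δ₁) ≠ 0 := (Real.rpow_pos_of_pos hbpos _).ne'
  rw [Real.div_rpow hnn hbpos.le]
  field_simp

/-! ### The glue T1 → Sray → r2 (registered name) -/

/-- **TOWER × RAYS glue (registered): T1 → Sray → r2.** From the ray law at `Δ`: S2 at `Δ`
(`dilationLawAt_of_rayLawAt`), the uniform law at `Δ` (landed `stub_uniformDilationTransfer`), the axial pure
power law (`axisPowerLaw_of_towerLaw_of_dilationLawAt`), ratio isotropy (landed `stub_rayRigidityTransfer`),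
and the landed AXIS × ANGLE glue `IsingEuclidUpgradeR2RotInvPowerLaw_of_subs` concludes the route decl by name.
[cite: DuminilCopinICM2022, §8.1] -/
theorem IsingEuclidUpgradeR2RotInvPowerLaw_of_towerLaw_of_rayLaw : (∃ Δ c : ℝ, 0 < c ∧ Filter.Tendsto (fun j : ℕ => Literature.Probability.LatticeModels.criticalTwoPoint 3 (Pi.single 0 ((2 ^ j : ℕ) : ℤ)) * ((2 ^ j : ℕ) : ℝ) ^ (2 * Δ)) Filter.atTop (nhds c)) → (∃ Δ : ℝ, ∀ v : Literature.Probability.LatticeModels.Site 3, v ≠ 0 → ∀ k : ℕ, 1 ≤ k → Filter.Tendsto (fun n : ℕ => Literature.Probability.LatticeModels.criticalTwoPoint 3 (((k * n : ℕ) : ℤ) • v) * (k : ℝ) ^ (2 * Δ) / Literature.Probability.LatticeModels.criticalTwoPoint 3 (((n : ℕ) : ℤ) • v)) Filter.atTop (nhds 1)) → Summit.CriticalPhenomena.Ising3DConformalLimit.Theses.IsingEuclidUpgrade.IsingEuclidUpgradeR2RotInvPowerLaw := by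
  intro hT hray
  obtain ⟨Δ, hr⟩ := hray
  have hS2 := dilationLawAt_of_rayLawAt hr
  exact IsingEuclidUpgradeR2RotInvPowerLaw_of_subs (axisPowerLaw_of_towerLaw_of_dilationLawAt hT hS2)
    (stub_rayRigidityTransfer Δ hr (stub_uniformDilationTransfer Δ hS2))

/-- The bet route's copy: the same two radial statements conclude
`Theses.PrecisionLaplacian.IsingEuclidUpgradeR2RotInvPowerLaw` (item 0634 on route PrecisionLaplacian), which is
the same proposition. [cite: DuminilCopinICM2022, §8.1] -/
theorem PrecisionLaplacian_IsingEuclidUpgradeR2RotInvPowerLaw_of_towerLaw_of_rayLaw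
    (hT : ∃ Δ c : ℝ, 0 < c ∧ Filter.Tendsto (fun j : ℕ => Literature.Probability.LatticeModels.criticalTwoPoint 3 (Pi.single 0 ((2 ^ j : ℕ) : ℤ)) * ((2 ^ j : ℕ) : ℝ) ^ (2 * Δ)) Filter.atTop (nhds c))
    (hray : ∃ Δ : ℝ, ∀ v : Literature.Probability.LatticeModels.Site 3, v ≠ 0 → ∀ k : ℕ, 1 ≤ k → Filter.Tendsto (fun n : ℕ => Literature.Probability.LatticeModels.criticalTwoPoint 3 (((k * n : ℕ) : ℤ) • v) * (k : ℝ) ^ (2 * Δ) / Literature.Probability.LatticeModels.criticalTwoPoint 3 (((n : ℕ) : ℤ) • v)) Filter.atTop (nhds 1)) :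
    Summit.CriticalPhenomena.Ising3DConformalLimit.Theses.PrecisionLaplacian.IsingEuclidUpgradeR2RotInvPowerLaw :=
  IsingEuclidUpgradeR2RotInvPowerLaw_of_towerLaw_of_rayLaw hT hray

/-! ### Converses: the split is lossless -/

/-- **r2 ⇒ T1**: restrict the axial law (landed `axisPowerLaw_of_rotInvPowerLaw`) to the tower `n = 2^j`.
[folklore] -/
theorem towerLaw_of_rotInvPowerLaw
    (h : Summit.CriticalPhenomena.Ising3DConformalLimit.Theses.IsingEuclidUpgrade.IsingEuclidUpgradeR2RotInvPowerLaw) :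
    ∃ Δ c : ℝ, 0 < c ∧ Filter.Tendsto (fun j : ℕ => Literature.Probability.LatticeModels.criticalTwoPoint 3 (Pi.single 0 ((2 ^ j : ℕ) : ℤ)) * ((2 ^ j : ℕ) : ℝ) ^ (2 * Δ)) Filter.atTop (nhds c) := by
  obtain ⟨Δ, c, hc, hax⟩ := axisPowerLaw_of_rotInvPowerLaw h
  exact ⟨Δ, c, hc, hax.comp (tendsto_pow_atTop_atTop_of_one_lt one_lt_two)⟩

/-- Rewriting: tree-form ray regular variation `G(kmx)/G(mx) → k^{-a}` gives the ray dilation law with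
`Δ = a/2`. [folklore] -/
theorem rayLaw_of_rayRV
    (h : ∃ a : ℝ, ∀ x : Site 3, x ≠ 0 → ∀ k : ℕ, 1 ≤ k →
      Tendsto (fun m : ℕ => criticalTwoPoint 3 (fun i => ((k * m : ℕ) : ℤ) * x i) /
        criticalTwoPoint 3 (fun i => ((m : ℕ) : ℤ) * x i)) atTop (𝓝 ((k : ℝ) ^ (-a)))) :
    ∃ Δ : ℝ, ∀ v : Literature.Probability.LatticeModels.Site 3, v ≠ 0 → ∀ k : ℕ, 1 ≤ k → Filter.Tendsto (fun n : ℕ => Literature.Probability.LatticeModels.criticalTwoPoint 3 (((k * n : ℕ) : ℤ) • v) * (k : ℝ) ^ (2 * Δ) / Literature.Probability.LatticeModels.criticalTwoPoint 3 (((n : ℕ) : ℤ) • v)) Filter.atTop (nhds 1) := by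
  obtain ⟨a, hRV⟩ := h
  refine ⟨a / 2, fun v hv k hk => ?_⟩
  have hk0 : (0 : ℝ) < k := by exact_mod_cast hk
  have hka : (k : ℝ) ^ a ≠ 0 := (Real.rpow_pos_of_pos hk0 _).ne'
  have h := (hRV v hv k hk).mul_const ((k : ℝ) ^ a)
  rw [Real.rpow_neg hk0.le, inv_mul_cancel₀ hka] at h
  refine h.congr fun n => ?_
  have e1 : ((((k * n : ℕ) : ℤ) • v : Site 3)) = fun i => ((k * n : ℕ) : ℤ) * v i := by
    funext i; simp [Pi.smul_apply]
  have e2 : ((((n : ℕ) : ℤ) • v : Site 3)) = fun i => ((n : ℕ) : ℤ) * v i := by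
    funext i; simp [Pi.smul_apply]
  rw [e1, e2, show 2 * (a / 2) = a by ring]
  ring

/-- **r2 ⇒ Sray** (through the landed `RayRV.rayRV_of_rotInvPowerLaw`). [cite: DuminilCopinICM2022, §8.1] -/
theorem rayLaw_of_rotInvPowerLaw
    (h : Summit.CriticalPhenomena.Ising3DConformalLimit.Theses.IsingEuclidUpgrade.IsingEuclidUpgradeR2RotInvPowerLaw) :
    ∃ Δ : ℝ, ∀ v : Literature.Probability.LatticeModels.Site 3, v ≠ 0 → ∀ k : ℕ, 1 ≤ k → Filter.Tendsto (fun n : ℕ => Literature.Probability.LatticeModels.criticalTwoPoint 3 (((k * n : ℕ) : ℤ) • v) * (k : ℝ) ^ (2 * Δ) / Literature.Probability.LatticeModels.criticalTwoPoint 3 (((n : ℕ) : ℤ) • v)) Filter.atTop (nhds 1) :=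
  rayLaw_of_rayRV (rayRV_of_rotInvPowerLaw h)

/-- **The crux is EQUIVALENT to TOWER ∧ RAYS (registered name `rotInvPowerLaw_iff_towerLaw_and_rayLaw`):**
`r2 ↔ T1 ∧ Sray`. Refuting either radial child refutes the crux; proving both proves it.
[cite: DuminilCopinICM2022, §8.1] -/
theorem rotInvPowerLaw_iff_towerLaw_and_rayLaw : Summit.CriticalPhenomena.Ising3DConformalLimit.Theses.IsingEuclidUpgrade.IsingEuclidUpgradeR2RotInvPowerLaw ↔ ((∃ Δ c : ℝ, 0 < c ∧ Filter.Tendsto (fun j : ℕ => Literature.Probability.LatticeModels.criticalTwoPoint 3 (Pi.single 0 ((2 ^ j : ℕ) : ℤ)) * ((2 ^ j : ℕ) : ℝ) ^ (2 * Δ)) Filter.atTop (nhds c)) ∧ (∃ Δ : ℝ, ∀ v : Literature.Probability.LatticeModels.Site 3, v ≠ 0 → ∀ k : ℕ, 1 ≤ k → Filter.Tendsto (fun n : ℕ => Literature.Probability.LatticeModels.criticalTwoPoint 3 (((k * n : ℕ) : ℤ) • v) * (k : ℝ) ^ (2 * Δ) / Literature.Probability.LatticeModels.criticalTwoPoint 3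 (((n : ℕ) : ℤ) • v)) Filter.atTop (nhds 1))) :=
  ⟨fun h => ⟨towerLaw_of_rotInvPowerLaw h, rayLaw_of_rotInvPowerLaw h⟩,
    fun h => IsingEuclidUpgradeR2RotInvPowerLaw_of_towerLaw_of_rayLaw h.1 h.2⟩

end Summit.CriticalPhenomena.Ising3DConformalLimit.Cruxes.IsingEuclidUpgradeR2RotInvPowerLaw.TowerProfileRigidity

end
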